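import Mathlib.NumberTheory.NumberField.AdeleRing
import Mathlib.NumberTheory.NumberField.CanonicalEmbedding.Basic
import Mathlib.Algebra.Module.ZLattice.Basic
import Mathlib.RingTheory.DedekindDomain.Ideal.Lemmas
import Mathlib.Topology.Algebra.Group.Quotient
import Mathlib.MeasureTheory.Measure.Haar.DistribChar
import Mathlib.MeasureTheory.Measure.Haar.NormedSpace
import Literature.NumberTheory.Automorphic.AdelicGroupData
import HarnessLib

/-!
# Topology of the adele ring: `K ⊆ 𝔸_K` is discrete and cocompact; the module of a real scalar

Trunk `AutomorphicAxiomatic` (G19), topic `NumberTheory/Automorphic`; namespace `Literature.Automorphic`.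

For a number field `K` with adele ring `𝔸_K = K_∞ × 𝔸_K^∞` (Mathlib `NumberField.AdeleRing (𝓞 K) K`)
we prove the two halves of the classical **"`K ⊆ 𝔸_K` is a discrete cocompact subgroup"**
(Cassels–Fröhlich, Ch. II §14, Theorem; Weil, *Basic Number Theory*, Ch. IV §2, Thm. 2 with
`E = k`; Tate's thesis, Thm. 4.1.4 / Cor.):

* `AdeleRing.discreteTopology_principalSubgroup` — the principal adeles form a discrete subgroup
  (proof: `∏_v 𝒪_v` is an open neighbourhood of `0` in `𝔸_K^∞` meeting `K` in `𝓞 K`, and the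
  image of `𝓞 K` in `K_∞ ≅ ℝ^{r₁} × ℂ^{r₂}` is a discrete lattice — Mathlib
  `NumberField.mixedEmbedding.integerLattice`);
* `AdeleRing.exists_isCompact_forall_exists_sub_mem` — there is a compact `C ⊆ 𝔸_K` with
  `𝔸_K = K + C`, hence (`AdeleRing.compactSpace_quotient_principalSubgroup`) `𝔸_K ⧸ K` is compact,
  *granted* compactness of the local integer rings `𝒪_v` (an instance hypothesis
  `[∀ v, CompactSpace (v.adicCompletionIntegers K)]`, proved in `AdicCompletionCompact`).

The cocompactness proof is the classical one: **(finite part)** every finite adele is congruent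
to an element of `K` modulo `∏_v 𝒪_v` (`FiniteAdeleRing.exists_forall_sub_algebraMap_mem`:
clear denominators with a global `d ∈ 𝓞 K`, approximate at the primes dividing `d`, and glue with
the Chinese remainder theorem — Cassels–Fröhlich II §14–15, "strong approximation in its weakest
form"); **(infinite part)** `K_∞ = F + 𝓞 K` for a compact `F`, because `𝓞 K` is a full lattice in
`K_∞ ≅ ℝ^{r₁} × ℂ^{r₂}` with bounded fundamental parallelotope (Mathlib `ZSpan.fract`,
`ZSpan.norm_fract_le`, `mixedEmbedding.latticeBasis`). We also record the homeomorphism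
`infiniteAdeleRingHomeomorph : K_∞ ≃ₜ mixedSpace K` underlying Mathlib's ring isomorphism
`InfiniteAdeleRing.ringEquiv_mixedSpace` (they agree definitionally).

Finally (`AdeleRing.distribHaarChar_posRealIdele`, `AdeleRing.addHaar_posRealIdele_smul`) we
compute the **module of a positive real scalar** `t`, embedded diagonally at the infinite places
(`posRealIdele K t`, from `AdelicGroupData`), on the locally compact group `𝔸_K`:
`vol(t • s) = t^{[K:ℚ]} vol(s)` for every regular Haar measure — Weil, BNT IV §4, Cor. 2 of
Thm. 5 (`|z(λ)|_A = λⁿ`). The proof pushes a Haar measure of `𝔸_K = K_∞ × 𝔸_K^∞` forward to a Haar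
measure of the real vector space `ℝ^{r₁} × ℂ^{r₂}` (dimension `[K:ℚ]`) and uses Mathlib's
`Measure.addHaar_smul`; local compactness of `𝔸_K` is an instance hypothesis here (proved in
`AdicCompletionCompact`).

The finite-adelic statements are proved for any Dedekind domain `R` with fraction field `K`.

## References

* J. W. S. Cassels, A. Fröhlich (eds.), *Algebraic Number Theory* (1967), Ch. II (Cassels,
  *Global fields*) §§13–15, in particular §14 Theorem (`k` discrete in `V_k`, `V_k / k` compact).
  [CasselsFrohlichANT1967]
* A. Weil, *Basic Number Theory* (1967), Ch. IV §2, Thm. 2 (with Lemmas 1–2 of its proof);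
  Ch. IV §4, Cor. 2 of Thm. 5. [WeilBNT1967]
-/

noncomputable section

open NumberField InfinitePlace NumberField.InfinitePlace.Completion IsDedekindDomain
  IsDedekindDomain.HeightOneSpectrum WithZero MeasureTheory Measure
open scoped RestrictedProduct NNReal ENNReal Pointwise

namespace Literature.NumberTheory.Automorphic

/-! ### Finite adeles: `𝔸_K^∞ = K + ∏_v 𝒪_v` -/

section FinitePart

variable (R : Type*) [CommRing R] [IsDedekindDomain R] (K : Type*) [Field K] [Algebra R K]
  [IsFractionRing R K]

/-- Components of finite adeles multiply: `(x * y) v = x v * y v` (definitional). [folklore] -/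
theorem FiniteAdeleRing.mul_apply' (x y : FiniteAdeleRing R K) (v : HeightOneSpectrum R) :
    (x * y) v = x v * y v := rfl

/-- Components of finite adeles subtract: `(x - y) v = x v - y v` (definitional). [folklore] -/
theorem FiniteAdeleRing.sub_apply' (x y : FiniteAdeleRing R K) (v : HeightOneSpectrum R) :
    (x - y) v = x v - y v := rfl

/-- The `v`-component of the finite adele of `r ∈ R` is the image of `r` in `K_v`. [folklore] -/
theorem FiniteAdeleRing.algebraMap_int_apply (r : R) (v : HeightOneSpectrum R) :
    algebraMap R (FiniteAdeleRing R K) r v = algebraMap R (v.adicCompletion K) r := by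
  rw [IsScalarTower.algebraMap_apply R K (FiniteAdeleRing R K), FiniteAdeleRing.algebraMap_apply,
    IsScalarTower.algebraMap_apply R K (v.adicCompletion K)]
  rfl

/-- The coercion `K → K_v` is the algebra map. [folklore] -/
theorem adicCompletion_coe_eq_algebraMap (v : HeightOneSpectrum R) (k : K) :
    (k : v.adicCompletion K) = algebraMap K (v.adicCompletion K) k := by
  rw [algebraMap_adicCompletion]
  rfl

/-- The valuation of the image in `K_v` of `s ∈ R` is its `v`-adic integral valuation. [folklore] -/
theorem valued_algebraMap_adicCompletion (v : HeightOneSpectrum R) (s : R) :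
    Valued.v (algebraMap R (v.adicCompletion K) s) = v.intValuation s := by
  rw [algebraMap_adicCompletion, Function.comp_apply, valuedAdicCompletion_eq_valuation',
    valuation_of_algebraMap]

/-- The image of `R` in `K_v` lies in `𝒪_v`. [folklore] -/
theorem algebraMap_mem_adicCompletionIntegers (v : HeightOneSpectrum R) (s : R) :
    algebraMap R (v.adicCompletion K) s ∈ v.adicCompletionIntegers K := by
  rw [algebraMap_adicCompletion]
  exact coe_algebraMap_mem R K v s

/-- **Density of `R` in `𝒪_v` to any precision**: a `v`-adic integer `x ∈ K_v` is congruent to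
the image of an element of `R` modulo any non-zero `z ∈ K_v`, i.e. `v (r - x) < v (z)`
(`K` is dense in `K_v` and `R` is dense in `K ∩ 𝒪_v`, Mathlib
`HeightOneSpectrum.denseRange_algebraMap`, `exists_valuation_sub_lt_of_integer`).
Cassels–Fröhlich II §15 (proof of the strong approximation theorem, first step). [folklore] -/
theorem exists_valued_algebraMap_sub_lt (v : HeightOneSpectrum R) {x : v.adicCompletion K}
    (hx : Valued.v x ≤ 1) {z : v.adicCompletion K} (hz : z ≠ 0) :
    ∃ r : R, Valued.v (algebraMap R (v.adicCompletion K) r - x) < Valued.v z := by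
  have hval : ∀ c : K, Valued.v (algebraMap K (v.adicCompletion K) c) = v.valuation K c :=
    fun c => valuedAdicCompletion_eq_valuation' v c
  have hz' : (Valued.v z : ℤᵐ⁰) ≠ 0 := (Valuation.ne_zero_iff _).2 hz
  -- an element of `K` which is `v z`-close and `1`-close to `x`
  have hopen : IsOpen ({y : v.adicCompletion K | Valued.v (y - x) < Valued.v z} ∩
      {y | Valued.v (y - x) < 1}) := by
    refine IsOpen.inter ?_ ?_
    · have h1 : IsOpen {y : v.adicCompletion K | Valued.v y < Valued.v z} := by
        simpa only [Valuation.restrict_lt_iff] using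
          Valued.isOpen_ball (v.adicCompletion K) (Valued.v.restrict z)
      exact h1.preimage (continuous_id.sub continuous_const)
    · have h1 : IsOpen {y : v.adicCompletion K | Valued.v y < 1} := by
        simpa only [Valuation.restrict_lt_one_iff] using Valued.isOpen_ball (v.adicCompletion K) 1
      exact h1.preimage (continuous_id.sub continuous_const)
  obtain ⟨k, hk, hk1'⟩ := (denseRange_algebraMap K v).exists_mem_open hopen
    ⟨x, by simp [pos_iff_ne_zero, hz']⟩
  rw [Set.mem_setOf_eq] at hk hk1'
  -- `k` is a `v`-integer of `K`
  have hk1 : v.valuation K k ≤ 1 := by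
    rw [← hval]
    have := Valuation.map_add Valued.v (algebraMap K (v.adicCompletion K) k - x) x
    rw [sub_add_cancel] at this
    exact this.trans (max_le hk1'.le hx)
  -- approximate `k` by an element of `R`
  obtain ⟨r, hr⟩ := v.exists_valuation_sub_lt_of_integer hk1 (Units.mk0 _ hz')
  refine ⟨r, ?_⟩
  have h2 : Valued.v (algebraMap R (v.adicCompletion K) r -
      algebraMap K (v.adicCompletion K) k) < Valued.v z := by
    rw [IsScalarTower.algebraMap_apply R K (v.adicCompletion K), ← map_sub, hval]
    exact hr
  have := Valuation.map_add_lt Valued.v h2 hk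
  rwa [sub_add_sub_cancel] at this

/-- **Global denominators**: every finite adele `a` becomes integral at all places after
multiplication by a suitable non-zero `d ∈ R` (its finitely many non-integral components have
local denominators in `R`, Mathlib `adicCompletion.mul_nonZeroDivisor_mem_adicCompletionIntegers`).
Cassels–Fröhlich II §14. [folklore] -/
theorem FiniteAdeleRing.exists_ne_zero_forall_mul_mem (a : FiniteAdeleRing R K) :
    ∃ d : R, d ≠ 0 ∧
      ∀ v, (algebraMap R (FiniteAdeleRing R K) d * a) v ∈ v.adicCompletionIntegers K := by
  classical
  -- the finitely many places where `a` is not integral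
  have hS : {v : HeightOneSpectrum R | a v ∉ v.adicCompletionIntegers K}.Finite := by
    have := a.2
    rwa [Filter.eventually_cofinite] at this
  -- local denominators
  choose b hb hab using fun v : HeightOneSpectrum R =>
    adicCompletion.mul_nonZeroDivisor_mem_adicCompletionIntegers v (a v)
  refine ⟨∏ w ∈ hS.toFinset, b w, ?_, fun v => ?_⟩
  · exact Finset.prod_ne_zero_iff.2 fun w _ => nonZeroDivisors.ne_zero (hb w)
  · rw [FiniteAdeleRing.mul_apply', FiniteAdeleRing.algebraMap_int_apply]
    by_cases hv : a v ∈ v.adicCompletionIntegers K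
    · exact mul_mem (algebraMap_mem_adicCompletionIntegers R K v _) hv
    · have hvS : v ∈ hS.toFinset := hS.mem_toFinset.2 hv
      rw [← Finset.mul_prod_erase _ _ hvS, map_mul, mul_comm, ← mul_assoc]
      exact mul_mem (hab v) (algebraMap_mem_adicCompletionIntegers R K v _)

/-- **`𝔸_K^∞ = K + ∏_v 𝒪_v`** (partial fractions / the weak form of strong approximation): every
finite adele is congruent to a principal one modulo the integral adeles. Proof: with `d` as in
`FiniteAdeleRing.exists_ne_zero_forall_mul_mem` and `c = d a ∈ ∏_v 𝒪_v`, choose by the Chinese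
remainder theorem (Mathlib `IsDedekindDomain.exists_forall_sub_mem_ideal`) a `y ∈ R` with
`v (c_v - y) ≤ v (d)` at the primes `v ∣ d`; then `a - y/d = (c - y)/d` is integral everywhere.
Cassels–Fröhlich II §14 (proof of the Theorem, `V_k = k + ∏ 𝔬_v × …`) and §15. [cite: CasselsFrohlichANT1967, Ch. II §14 (proof of Theorem) and §15] -/
theorem FiniteAdeleRing.exists_forall_sub_algebraMap_mem (a : FiniteAdeleRing R K) :
    ∃ k : K, ∀ v, (a - algebraMap K (FiniteAdeleRing R K) k) v ∈ v.adicCompletionIntegers K := by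
  classical
  obtain ⟨d, hd0, hd⟩ := FiniteAdeleRing.exists_ne_zero_forall_mul_mem R K a
  set c : FiniteAdeleRing R K := algebraMap R (FiniteAdeleRing R K) d * a with hc
  -- the finitely many prime factors of `d`
  have hT : {v : HeightOneSpectrum R | v.intValuation d < 1}.Finite := by
    simp_rw [intValuation_lt_one_iff_dvd]
    apply Ideal.finite_factors
    simpa only [Submodule.zero_eq_bot, ne_eq, Ideal.span_singleton_eq_bot]
  have hval := valued_algebraMap_adicCompletion R K
  have hdv : ∀ v : HeightOneSpectrum R, algebraMap R (v.adicCompletion K) d ≠ 0 := fun v =>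
    (Valuation.ne_zero_iff Valued.v).1 (by rw [hval]; exact intValuation_ne_zero v d hd0)
  -- local approximations of `c_v` to precision `v(d)`
  choose r hr using fun v : HeightOneSpectrum R =>
    exists_valued_algebraMap_sub_lt R K v ((mem_adicCompletionIntegers R K v).1 (hd v)) (hdv v)
  -- Chinese remainder theorem in `R`
  obtain ⟨y, hy⟩ := IsDedekindDomain.exists_forall_sub_mem_ideal (s := hT.toFinset)
    (fun v : HeightOneSpectrum R => v.asIdeal)
    (fun v => multiplicity v.asIdeal (Ideal.span {d})) (fun v _ => v.prime)
    (fun v _ w _ hvw => fun h => hvw (HeightOneSpectrum.ext h)) (fun v => r v.1)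
  refine ⟨algebraMap R K y / algebraMap R K d, fun v => ?_⟩
  -- the key estimate `v (c_v - y) ≤ v (d)` at every place `v`
  have key : Valued.v (c v - algebraMap R (v.adicCompletion K) y) ≤
      Valued.v (algebraMap R (v.adicCompletion K) d) := by
    by_cases hvT : v.intValuation d < 1
    · have hvT' : v ∈ hT.toFinset := hT.mem_toFinset.2 hvT
      have h1 : Valued.v (c v - algebraMap R (v.adicCompletion K) (r v)) <
          Valued.v (algebraMap R (v.adicCompletion K) d) := by
        rw [← Valuation.map_neg, neg_sub]; exact hr v
      have h2 : Valued.v (algebraMap R (v.adicCompletion K) (r v) -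
          algebraMap R (v.adicCompletion K) y) ≤
          Valued.v (algebraMap R (v.adicCompletion K) d) := by
        rw [← map_sub, hval, hval, intValuation_eq_exp_neg_multiplicity v hd0,
          intValuation_le_pow_iff_mem, ← neg_sub, neg_mem_iff]
        exact hy v hvT'
      have := Valuation.map_add Valued.v (c v - algebraMap R (v.adicCompletion K) (r v))
        (algebraMap R (v.adicCompletion K) (r v) - algebraMap R (v.adicCompletion K) y)
      rw [sub_add_sub_cancel] at this
      exact this.trans (max_le h1.le h2)
    · have hd1 : Valued.v (algebraMap R (v.adicCompletion K) d) = 1 := by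
        rw [hval]
        exact le_antisymm (intValuation_le_one v d) (not_lt.1 hvT)
      rw [hd1]
      exact Valuation.map_sub_le _ ((mem_adicCompletionIntegers R K v).1 (hd v))
        ((mem_adicCompletionIntegers R K v).1 (algebraMap_mem_adicCompletionIntegers R K v y))
  -- rewrite `a - y/d = (c - y) / d` at `v` and conclude
  have hcv : c v = algebraMap R (v.adicCompletion K) d * a v := by
    rw [hc, FiniteAdeleRing.mul_apply', FiniteAdeleRing.algebraMap_int_apply]
  rw [mem_adicCompletionIntegers, FiniteAdeleRing.sub_apply', FiniteAdeleRing.algebraMap_apply]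
  have : ((algebraMap R K y / algebraMap R K d : K) : v.adicCompletion K) =
      algebraMap R (v.adicCompletion K) y / algebraMap R (v.adicCompletion K) d := by
    rw [adicCompletion_coe_eq_algebraMap, map_div₀, ← IsScalarTower.algebraMap_apply,
      ← IsScalarTower.algebraMap_apply]
  rw [this]
  have e : a v - algebraMap R (v.adicCompletion K) y / algebraMap R (v.adicCompletion K) d =
      (c v - algebraMap R (v.adicCompletion K) y) / algebraMap R (v.adicCompletion K) d := by
    rw [eq_div_iff (hdv v), sub_mul, div_mul_cancel₀ _ (hdv v), hcv, mul_comm]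
  rw [e, map_div₀]
  exact div_le_one_of_le₀ key zero_le

/-- The integral finite adeles `∏_v 𝒪_v ⊆ 𝔸_K^∞` form an open subset (Mathlib
`RestrictedProduct.isOpen_forall_mem`, each `𝒪_v` being open in `K_v`). [folklore] -/
theorem FiniteAdeleRing.isOpen_setOf_forall_mem :
    IsOpen {a : FiniteAdeleRing R K | ∀ v, a v ∈ v.adicCompletionIntegers K} :=
  RestrictedProduct.isOpen_forall_mem
    (R := fun v : HeightOneSpectrum R => v.adicCompletion K)
    (A := fun v : HeightOneSpectrum R =>
      ((v.adicCompletionIntegers K : ValuationSubring (v.adicCompletion K)) :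
        Set (v.adicCompletion K)))
    fun v => Valued.isOpen_valuationSubring (v.adicCompletion K)

/-- **The integral finite adeles `∏_v 𝒪_v` form a compact subset of `𝔸_K^∞`**, granted that every
`𝒪_v` is compact (Tychonoff, and the structure map `∏_v 𝒪_v → 𝔸_K^∞` is continuous).
Cassels–Fröhlich II §13–14. [folklore] -/
theorem FiniteAdeleRing.isCompact_setOf_forall_mem
    [∀ v : HeightOneSpectrum R, CompactSpace (v.adicCompletionIntegers K)] :
    IsCompact {a : FiniteAdeleRing R K | ∀ v, a v ∈ v.adicCompletionIntegers K} := by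
  have h := isCompact_range (RestrictedProduct.isEmbedding_structureMap
    (R := fun v : HeightOneSpectrum R => v.adicCompletion K)
    (A := fun v : HeightOneSpectrum R => (v.adicCompletionIntegers K : Set (v.adicCompletion K)))
    (𝓕 := Filter.cofinite)).continuous
  rw [RestrictedProduct.range_structureMap] at h
  exact h

/-- An element of `K` which is integral at every finite place lies in `R`
(Mathlib `HeightOneSpectrum.mem_integers_of_valuation_le_one`, phrased with the completions). [folklore] -/
theorem exists_algebraMap_eq_of_forall_coe_mem (k : K)
    (hk : ∀ v : HeightOneSpectrum R, (k : v.adicCompletion K) ∈ v.adicCompletionIntegers K) :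
    ∃ r : R, algebraMap R K r = k := by
  have h : ∀ v : HeightOneSpectrum R, v.valuation K k ≤ 1 := fun v => by
    rw [← valuedAdicCompletion_eq_valuation' v k]
    exact (mem_adicCompletionIntegers R K v).1 (hk v)
  exact HeightOneSpectrum.mem_integers_of_valuation_le_one K k h

end FinitePart

/-! ### Infinite adeles: `K_∞ = F + 𝓞 K` with `F` compact -/

section InfinitePart

variable (K : Type*) [Field K] [NumberField K]

open scoped Classical in
/-- Mathlib's ring isomorphism `K_∞ ≃+* ℝ^{r₁} × ℂ^{r₂}` (`InfiniteAdeleRing.ringEquiv_mixedSpace`)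
as a **homeomorphism**: it is assembled from the isometries `K_v ≃ᵢ ℝ` (`v` real) and
`K_v ≃ᵢ ℂ` (`v` complex) exactly as the ring isomorphism is assembled from the underlying ring
isomorphisms, so the two agree definitionally (`coe_infiniteAdeleRingHomeomorph`). [folklore] -/
def infiniteAdeleRingHomeomorph : InfiniteAdeleRing K ≃ₜ mixedEmbedding.mixedSpace K :=
  Homeomorph.trans
    (Homeomorph.piEquivPiSubtypeProd (fun (v : InfinitePlace K) => IsReal v)
      (fun (v : InfinitePlace K) => v.Completion))
    (Homeomorph.prodCongr
      (Homeomorph.piCongrRight (fun v => (isometryEquivRealOfIsReal v.2).toHomeomorph))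
      (Homeomorph.trans
        (Homeomorph.piCongrRight (fun v => (isometryEquivComplexOfIsComplex
          ((not_isReal_iff_isComplex.1 v.2))).toHomeomorph))
        (Homeomorph.piCongrLeft (Y := fun _ => ℂ) <|
          Equiv.subtypeEquivRight (fun _ => not_isReal_iff_isComplex))))

omit [NumberField K] in
/-- The homeomorphism `K_∞ ≃ₜ ℝ^{r₁} × ℂ^{r₂}` *is* Mathlib's ring isomorphism
`InfiniteAdeleRing.ringEquiv_mixedSpace` (definitionally). [folklore] -/
@[simp]
theorem coe_infiniteAdeleRingHomeomorph :
    ⇑(infiniteAdeleRingHomeomorph K) = ⇑(InfiniteAdeleRing.ringEquiv_mixedSpace K) := rfl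

omit [NumberField K] in
/-- The underlying equivalence of `infiniteAdeleRingHomeomorph` is that of
`InfiniteAdeleRing.ringEquiv_mixedSpace` (definitionally); in particular the inverses agree. [folklore] -/
theorem infiniteAdeleRingHomeomorph_toEquiv :
    (infiniteAdeleRingHomeomorph K).toEquiv =
      (InfiniteAdeleRing.ringEquiv_mixedSpace K).toEquiv := rfl

open scoped Classical in
/-- **`𝓞 K` is cocompact in `K_∞`**: there is a compact `F ⊆ K_∞` with `K_∞ = F + 𝓞 K`. The image
of `𝓞 K` in `ℝ^{r₁} × ℂ^{r₂}` is a full lattice with `ℤ`-basis `mixedEmbedding.latticeBasis K`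
(Mathlib), every point is a lattice translate of a point of the fundamental parallelotope
(`ZSpan.fract`), and the latter is bounded (`ZSpan.norm_fract_le`). Cassels–Fröhlich II §14
(proof of the Theorem: `k_∞ = P + 𝔬`); Weil, BNT IV §2. [folklore] -/
theorem InfiniteAdeleRing.exists_isCompact_forall_exists_sub_mem :
    ∃ F : Set (InfiniteAdeleRing K), IsCompact F ∧
      ∀ x : InfiniteAdeleRing K, ∃ m : 𝓞 K,
        x - algebraMap K (InfiniteAdeleRing K) m ∈ F := by
  set φ := infiniteAdeleRingHomeomorph K with hφ
  set b := mixedEmbedding.latticeBasis K with hb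
  refine ⟨φ ⁻¹' Metric.closedBall 0 (∑ i, ‖b i‖), ?_, fun x => ?_⟩
  · exact φ.isCompact_preimage.2 (isCompact_closedBall _ _)
  · -- `floor (φ x)` is the image of a global integer `m`
    have hm : ((ZSpan.floor b (φ x) : mixedEmbedding.mixedSpace K)) ∈
        mixedEmbedding.integerLattice K := by
      rw [← mixedEmbedding.mem_span_latticeBasis]
      exact (ZSpan.floor b (φ x)).2
    obtain ⟨m, hm'⟩ := hm
    refine ⟨m, ?_⟩
    rw [Set.mem_preimage, Metric.mem_closedBall, dist_zero_right, coe_infiniteAdeleRingHomeomorph,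
      map_sub, ← InfiniteAdeleRing.mixedEmbedding_eq_algebraMap_comp]
    have : mixedEmbedding K (m : K) = ZSpan.floor b (φ x) := hm'
    rw [this, ← coe_infiniteAdeleRingHomeomorph, ← ZSpan.fract_apply]
    exact ZSpan.norm_fract_le b _

/-- **`𝓞 K` is discrete in `K_∞`**: some open neighbourhood of `0` in `K_∞` contains no non-zero
global integer (Mathlib: `mixedEmbedding.integerLattice K` is a discrete subgroup of
`ℝ^{r₁} × ℂ^{r₂}`). Cassels–Fröhlich II §14; Weil, BNT IV §2. [folklore] -/
theorem InfiniteAdeleRing.exists_isOpen_forall_integer_eq_zero :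
    ∃ V : Set (InfiniteAdeleRing K), IsOpen V ∧ 0 ∈ V ∧
      ∀ m : 𝓞 K, algebraMap K (InfiniteAdeleRing K) m ∈ V → m = 0 := by
  set φ := infiniteAdeleRingHomeomorph K with hφ
  -- an open `u` in the mixed space isolating `0` in the integer lattice
  obtain ⟨u, hu, hu0⟩ := isOpen_induced_iff.1
    (isOpen_discrete ({0} : Set (mixedEmbedding.integerLattice K)))
  refine ⟨φ ⁻¹' u, hu.preimage φ.continuous, ?_, fun m hm => ?_⟩
  · have h0 : ((0 : mixedEmbedding.integerLattice K) : mixedEmbedding.mixedSpace K) ∈ u := by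
      have : (0 : mixedEmbedding.integerLattice K) ∈ Subtype.val ⁻¹' u := by
        rw [hu0]; exact Set.mem_singleton _
      exact this
    rw [Set.mem_preimage, coe_infiniteAdeleRingHomeomorph, map_zero]
    simpa only [Submodule.coe_zero] using h0
  · have hmL : mixedEmbedding K (m : K) ∈ mixedEmbedding.integerLattice K := ⟨m, rfl⟩
    have hmu : mixedEmbedding K (m : K) ∈ u := by
      rw [InfiniteAdeleRing.mixedEmbedding_eq_algebraMap_comp, ← coe_infiniteAdeleRingHomeomorph]
      exact hm
    have : (⟨_, hmL⟩ : mixedEmbedding.integerLattice K) ∈ Subtype.val ⁻¹' u := hmu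
    rw [hu0, Set.mem_singleton_iff, Subtype.ext_iff] at this
    have h0 : mixedEmbedding K (m : K) = 0 := this
    exact_mod_cast (map_eq_zero_iff _ (mixedEmbedding_injective K)).1 h0

end InfinitePart

/-! ### Two lemmas on subgroups of topological groups -/

section General

variable {B : Type*} [AddGroup B] [TopologicalSpace B]

/-- A subgroup `S` of a topological additive group is **discrete** as soon as some open
neighbourhood `U` of `0` contains no non-zero element of `S`. [folklore] -/
theorem AddSubgroup.discreteTopology_of_isOpen_forall_eq_zero [IsTopologicalAddGroup B]
    (S : AddSubgroup B) {U : Set B} (hU : IsOpen U) (h0 : (0 : B) ∈ U)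
    (h : ∀ x ∈ S, x ∈ U → x = 0) : DiscreteTopology S := by
  refine discreteTopology_of_isOpen_singleton_zero ?_
  have : ({0} : Set S) = Subtype.val ⁻¹' U := by
    ext ⟨x, hx⟩
    simp only [Set.mem_singleton_iff, Set.mem_preimage]
    constructor
    · intro hx0
      have : x = 0 := congrArg Subtype.val hx0
      rw [this]
      exact h0
    · intro hxU
      exact Subtype.ext (h x hx hxU)
  rw [this]
  exact hU.preimage continuous_subtype_val

/-- If a compact set `C` meets every coset of the subgroup `S` (i.e. `B = C + S`), then the
quotient `B ⧸ S` is **compact** (it is the continuous image of `C`). [folklore] -/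
theorem AddSubgroup.compactSpace_quotient_of_forall_exists_sub_mem (S : AddSubgroup B)
    {C : Set B} (hC : IsCompact C) (h : ∀ x : B, ∃ s ∈ S, x - s ∈ C) :
    CompactSpace (B ⧸ S) := by
  refine ⟨?_⟩
  have : (Set.univ : Set (B ⧸ S)) = (QuotientAddGroup.mk : B → B ⧸ S) '' C := by
    refine (Set.eq_univ_of_forall fun q => ?_).symm
    obtain ⟨x, rfl⟩ := QuotientAddGroup.mk_surjective q
    obtain ⟨s, hs, hxs⟩ := h x
    refine ⟨_, hxs, ?_⟩
    rw [QuotientAddGroup.eq]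
    have : -(x - s) + x = s := by rw [neg_sub, sub_add_cancel]
    rw [this]
    exact hs
  rw [this]
  exact hC.image QuotientAddGroup.continuous_mk

end General

/-! ### The adele ring: `𝔸_K = K + C` with `C` compact, and `K` is discrete -/

section Adeles

variable (K : Type*) [Field K] [NumberField K]

/-- Components: `(x - y).1 = x.1 - y.1` in `𝔸_K = K_∞ × 𝔸_K^∞` (definitional). [folklore] -/
theorem AdeleRing.fst_sub (x y : AdeleRing (𝓞 K) K) : (x - y).1 = x.1 - y.1 := rfl

/-- Components: `(x - y).2 = x.2 - y.2` in `𝔸_K = K_∞ × 𝔸_K^∞` (definitional). [folklore] -/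
theorem AdeleRing.snd_sub (x y : AdeleRing (𝓞 K) K) : (x - y).2 = x.2 - y.2 := rfl

/-- The archimedean component of a principal adele (definitional). [folklore] -/
theorem AdeleRing.algebraMap_fst (k : K) :
    (algebraMap K (AdeleRing (𝓞 K) K) k).1 = algebraMap K (InfiniteAdeleRing K) k := rfl

/-- The finite component of a principal adele (definitional). [folklore] -/
theorem AdeleRing.algebraMap_snd (k : K) :
    (algebraMap K (AdeleRing (𝓞 K) K) k).2 = algebraMap K (FiniteAdeleRing (𝓞 K) K) k := rfl

/-- **`𝔸_K = K + C` with `C` compact** (fundamental set for `K` in `𝔸_K`), granted compactness of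
the local integer rings `𝒪_v`: `C = F × ∏_v 𝒪_v` with `F` from
`InfiniteAdeleRing.exists_isCompact_forall_exists_sub_mem`; a given adele is first made integral
at the finite places by a principal adele (`FiniteAdeleRing.exists_forall_sub_algebraMap_mem`) and
then moved into `F` by a global integer. Cassels–Fröhlich II §14, Theorem (proof); Weil, BNT
IV §2 Thm. 2. [cite: CasselsFrohlichANT1967, Ch. II §14 Theorem] -/
theorem AdeleRing.exists_isCompact_forall_exists_sub_mem
    [∀ v : HeightOneSpectrum (𝓞 K), CompactSpace (v.adicCompletionIntegers K)] :
    ∃ C : Set (AdeleRing (𝓞 K) K), IsCompact C ∧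
      ∀ x : AdeleRing (𝓞 K) K, ∃ k : K, x - algebraMap K (AdeleRing (𝓞 K) K) k ∈ C := by
  obtain ⟨F, hF, hFcov⟩ := InfiniteAdeleRing.exists_isCompact_forall_exists_sub_mem K
  set Cf : Set (FiniteAdeleRing (𝓞 K) K) := {a | ∀ v, a v ∈ v.adicCompletionIntegers K} with hCf
  have hCfc : IsCompact Cf := FiniteAdeleRing.isCompact_setOf_forall_mem (𝓞 K) K
  refine ⟨show Set (AdeleRing (𝓞 K) K) from F ×ˢ Cf, hF.prod hCfc, fun x => ?_⟩
  -- make `x` integral at the finite places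
  obtain ⟨k₁, hk₁⟩ := FiniteAdeleRing.exists_forall_sub_algebraMap_mem (𝓞 K) K x.2
  -- then move the archimedean component into `F` by a global integer
  obtain ⟨m, hm⟩ := hFcov (x.1 - algebraMap K (InfiniteAdeleRing K) k₁)
  refine ⟨k₁ + m, ?_, fun v => ?_⟩
  · rwa [AdeleRing.fst_sub, AdeleRing.algebraMap_fst, map_add, ← sub_sub]
  · rw [AdeleRing.snd_sub, AdeleRing.algebraMap_snd, map_add, ← sub_sub,
      FiniteAdeleRing.sub_apply', FiniteAdeleRing.algebraMap_apply]
    exact sub_mem (hk₁ v) (coe_algebraMap_mem (𝓞 K) K v m)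

/-- **`𝔸_K ⧸ K` is compact** (granted compactness of the local integer rings `𝒪_v`): the quotient
is the continuous image of the compact set `C` of
`AdeleRing.exists_isCompact_forall_exists_sub_mem`. Cassels–Fröhlich II §14, Theorem; Weil, BNT
IV §2 Thm. 2; Tate's thesis Thm. 4.1.4 Cor. [cite: CasselsFrohlichANT1967, Ch. II §14 Theorem] -/
theorem AdeleRing.compactSpace_quotient_principalSubgroup
    [∀ v : HeightOneSpectrum (𝓞 K), CompactSpace (v.adicCompletionIntegers K)] :
    CompactSpace (AdeleRing (𝓞 K) K ⧸ AdeleRing.principalSubgroup (𝓞 K) K) := by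
  obtain ⟨C, hC, hcov⟩ := AdeleRing.exists_isCompact_forall_exists_sub_mem K
  exact AddSubgroup.compactSpace_quotient_of_forall_exists_sub_mem _ hC fun x =>
    let ⟨k, hk⟩ := hcov x
    ⟨_, ⟨k, rfl⟩, hk⟩

/-- **`K` is discrete in `𝔸_K`**, in the concrete form: there is an open neighbourhood `U` of `0`
in `𝔸_K` containing no non-zero principal adele. Take `U = V × ∏_v 𝒪_v` with `V` from
`InfiniteAdeleRing.exists_isOpen_forall_integer_eq_zero`: a principal adele in `U` is a global
integer (integral at all finite places) lying in `V`, hence `0`. Cassels–Fröhlich II §14, Theorem;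
Weil, BNT IV §2 Thm. 2. [cite: CasselsFrohlichANT1967, Ch. II §14 Theorem] -/
theorem AdeleRing.exists_isOpen_forall_algebraMap_mem_eq_zero :
    ∃ U : Set (AdeleRing (𝓞 K) K), IsOpen U ∧ 0 ∈ U ∧
      ∀ k : K, algebraMap K (AdeleRing (𝓞 K) K) k ∈ U → k = 0 := by
  obtain ⟨V, hV, hV0, hVint⟩ := InfiniteAdeleRing.exists_isOpen_forall_integer_eq_zero K
  set O : Set (FiniteAdeleRing (𝓞 K) K) := {a | ∀ v, a v ∈ v.adicCompletionIntegers K} with hO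
  refine ⟨show Set (AdeleRing (𝓞 K) K) from V ×ˢ O,
    hV.prod (FiniteAdeleRing.isOpen_setOf_forall_mem (𝓞 K) K), ⟨hV0, fun v => ?_⟩,
    fun k hk => ?_⟩
  · exact zero_mem _
  · obtain ⟨hkinf, hkf⟩ := hk
    -- `k` is a global integer
    obtain ⟨m, rfl⟩ := exists_algebraMap_eq_of_forall_coe_mem (𝓞 K) K k hkf
    -- lying in `V`, hence zero
    have : m = 0 := hVint m hkinf
    rw [this, map_zero]

/-- **`K` is a discrete subgroup of `𝔸_K`** (the principal adeles carry the discrete topology).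
Cassels–Fröhlich II §14, Theorem; Weil, BNT IV §2 Thm. 2. [cite: CasselsFrohlichANT1967, Ch. II §14 Theorem] -/
theorem AdeleRing.discreteTopology_principalSubgroup :
    DiscreteTopology (AdeleRing.principalSubgroup (𝓞 K) K) := by
  obtain ⟨U, hU, hU0, hUK⟩ := AdeleRing.exists_isOpen_forall_algebraMap_mem_eq_zero K
  refine AddSubgroup.discreteTopology_of_isOpen_forall_eq_zero _ hU hU0 ?_
  rintro _ ⟨k, rfl⟩ hk
  change algebraMap K (AdeleRing (𝓞 K) K) k = 0
  rw [hUK k hk, map_zero]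

end Adeles

/-! ### The module of a positive real scalar on `𝔸_K` -/

section HaarScaling

variable (K : Type) [Field K] [NumberField K]

omit [NumberField K] in
/-- The homeomorphism `K_∞ ≃ₜ ℝ^{r₁} × ℂ^{r₂}` turns multiplication by the diagonal real scalar
`realToInfiniteAdele K r` into real scalar multiplication. [folklore] -/
theorem infiniteAdeleRingHomeomorph_realToInfiniteAdele_mul (r : ℝ) (y : InfiniteAdeleRing K) :
    infiniteAdeleRingHomeomorph K (realToInfiniteAdele K r * y) =
      r • infiniteAdeleRingHomeomorph K y := by
  rw [coe_infiniteAdeleRingHomeomorph, map_mul, realToInfiniteAdele, RingHom.comp_apply,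
    RingEquiv.toRingHom_eq_coe, RingEquiv.coe_toRingHom, RingEquiv.apply_symm_apply,
    Algebra.smul_def]

open scoped Classical in
/-- **Archimedean module of a real scalar on the adeles.** For `t > 0`, multiplication by the
idele `posRealIdele K t` (diagonal `t` at the infinite places, `1` at the finite places) scales
additive Haar measure of `𝔸_K` by `t ^ [K:ℚ]`: `Δ(posRealIdele K t) = t^{[K:ℚ]}`. Proof: for a
Haar measure `μ` on `𝔸_K = K_∞ × 𝔸_K^∞` and a compact `C ⊆ 𝔸_K^∞` with non-empty interior,
`S ↦ μ (φ⁻¹(S) × C)` is a Haar measure on the real vector space `ℝ^{r₁} × ℂ^{r₂} ≅ K_∞`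
(`φ = infiniteAdeleRingHomeomorph`) of dimension `[K:ℚ]`, on which real scalars act with module
`|t|^{[K:ℚ]}` (Mathlib `Measure.addHaar_smul`). Weil, BNT IV §4, Cor. 2 of Thm. 5
(`|z(λ)|_A = λⁿ`, `n = [k:ℚ]`); Vignéras II §4 (`‖x‖_ℝ = |x|`, `‖x‖_ℂ = |x|²`). [cite: WeilBNT1967, Ch. IV §4, Cor. 2 of Thm. 5] -/
theorem AdeleRing.distribHaarChar_posRealIdele [LocallyCompactSpace (AdeleRing (𝓞 K) K)]
    (t : ℝ≥0ˣ) :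
    distribHaarChar (AdeleRing (𝓞 K) K) (posRealIdele K t) = (t : ℝ≥0) ^ Module.finrank ℚ K := by
  borelize (AdeleRing (𝓞 K) K)
  set μ : Measure (AdeleRing (𝓞 K) K) := addHaar with hμ
  -- a compact `C ⊆ 𝔸_K^∞` with non-empty interior
  obtain ⟨N, hN, hN0⟩ := exists_compact_mem_nhds (0 : AdeleRing (𝓞 K) K)
  set C : Set (FiniteAdeleRing (𝓞 K) K) := Prod.snd '' N with hC
  have hCc : IsCompact C := hN.image continuous_snd
  have hCint : (0 : FiniteAdeleRing (𝓞 K) K) ∈ interior C :=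
    mem_interior.2 ⟨Prod.snd '' interior N, Set.image_mono interior_subset,
      isOpenMap_snd _ isOpen_interior,
      ⟨(0 : AdeleRing (𝓞 K) K), mem_interior_iff_mem_nhds.2 hN0, rfl⟩⟩
  -- the homeomorphism `φ : K_∞ → ℝ^{r₁} × ℂ^{r₂}` and `ψ = φ ∘ fst`
  set φ := infiniteAdeleRingHomeomorph K with hφ
  set ψ : AdeleRing (𝓞 K) K → mixedEmbedding.mixedSpace K := fun x => φ x.1 with hψ
  have hψc : Continuous ψ := φ.continuous.comp continuous_fst
  have hψm : Measurable ψ := hψc.measurable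
  -- the sets `φ⁻¹(S) × C ⊆ 𝔸_K`
  set bx : Set (mixedEmbedding.mixedSpace K) → Set (AdeleRing (𝓞 K) K) :=
    fun S => {x | φ x.1 ∈ S ∧ x.2 ∈ C} with hbx
  have hbxc : ∀ S, IsCompact S → IsCompact (bx S) := fun S hS =>
    (φ.isCompact_preimage.2 hS).prod hCc
  -- the measure `ν S = μ (φ⁻¹ S × C)` on the mixed space
  set ν : Measure (mixedEmbedding.mixedSpace K) := (μ.restrict (bx Set.univ)).map ψ with hν
  have hνS : ∀ S : Set (mixedEmbedding.mixedSpace K), MeasurableSet S → ν S = μ (bx S) := by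
    intro S hS
    rw [hν, Measure.map_apply hψm hS, Measure.restrict_apply (hψm hS)]
    congr 1
    ext x
    simp only [Set.mem_inter_iff, Set.mem_preimage, hψ, hbx, Set.mem_setOf_eq, Set.mem_univ,
      true_and]
  -- `ν` is left invariant
  haveI : ν.IsAddLeftInvariant := by
    refine (forall_measure_preimage_add_iff ν).1 fun y S hS => ?_
    rw [hνS _ (measurable_const_add y hS), hνS S hS]
    have : bx ((fun h => y + h) ⁻¹' S) =
        (fun h => (show AdeleRing (𝓞 K) K from (φ.symm y, 0)) + h) ⁻¹' (bx S) := by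
      ext x
      simp only [Set.mem_preimage, hbx, Set.mem_setOf_eq]
      change (y + φ x.1 ∈ S ∧ x.2 ∈ C) ↔ (φ (φ.symm y + x.1) ∈ S ∧ 0 + x.2 ∈ C)
      rw [zero_add, coe_infiniteAdeleRingHomeomorph, map_add, ← coe_infiniteAdeleRingHomeomorph,
        Homeomorph.apply_symm_apply]
    rw [this, measure_preimage_add]
  -- `ν` is a Haar measure: test on the closed unit ball
  set B₀ : Set (mixedEmbedding.mixedSpace K) := Metric.closedBall 0 1 with hB₀
  have hB₀c : IsCompact B₀ := isCompact_closedBall _ _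
  have hs₀top : μ (bx B₀) ≠ ∞ := (hbxc B₀ hB₀c).measure_lt_top.ne
  have hs₀0 : μ (bx B₀) ≠ 0 := by
    have hsub : {x : AdeleRing (𝓞 K) K | φ x.1 ∈ Metric.ball (0 : mixedEmbedding.mixedSpace K) 1 ∧
        x.2 ∈ interior C} ⊆ bx B₀ :=
      fun x hx => ⟨Metric.ball_subset_closedBall hx.1, interior_subset hx.2⟩
    have hopen : IsOpen {x : AdeleRing (𝓞 K) K |
        φ x.1 ∈ Metric.ball (0 : mixedEmbedding.mixedSpace K) 1 ∧ x.2 ∈ interior C} :=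
      (Metric.isOpen_ball.preimage φ.continuous).prod isOpen_interior
    have hne : {x : AdeleRing (𝓞 K) K |
        φ x.1 ∈ Metric.ball (0 : mixedEmbedding.mixedSpace K) 1 ∧ x.2 ∈ interior C}.Nonempty := by
      refine ⟨0, ?_, hCint⟩
      change φ 0 ∈ Metric.ball (0 : mixedEmbedding.mixedSpace K) 1
      rw [coe_infiniteAdeleRingHomeomorph, map_zero]
      exact Metric.mem_ball_self one_pos
    exact ((hopen.measure_pos μ hne).trans_le (measure_mono hsub)).ne'
  have hνB₀ : ν B₀ = μ (bx B₀) := hνS B₀ measurableSet_closedBall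
  haveI : ν.IsAddHaarMeasure := by
    refine isAddHaarMeasure_of_isCompact_nonempty_interior ν B₀ hB₀c ?_ ?_ ?_
    · rw [hB₀, interior_closedBall _ one_ne_zero]; exact ⟨0, Metric.mem_ball_self one_pos⟩
    · rw [hνB₀]; exact hs₀0
    · rw [hνB₀]; exact hs₀top
  -- compute the character on `bx B₀`
  refine distribHaarChar_eq_of_measure_smul_eq_mul (μ := μ) hs₀0 hs₀top ?_
  have ht0 : ((t : ℝ≥0) : ℝ) ≠ 0 := NNReal.coe_ne_zero.2 t.ne_zero
  have hset : posRealIdele K t • bx B₀ = bx (((t : ℝ≥0) : ℝ) • B₀) := by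
    ext x
    rw [Set.mem_smul_set_iff_inv_smul_mem, Units.smul_def, smul_eq_mul, ← map_inv]
    change ((φ (((posRealIdele K t⁻¹ : (AdeleRing (𝓞 K) K)ˣ) : AdeleRing (𝓞 K) K).1 * x.1) ∈ B₀ ∧
        ((posRealIdele K t⁻¹ : (AdeleRing (𝓞 K) K)ˣ) : AdeleRing (𝓞 K) K).2 * x.2 ∈ C) ↔
      (φ x.1 ∈ ((t : ℝ≥0) : ℝ) • B₀ ∧ x.2 ∈ C))
    rw [posRealIdele_fst, posRealIdele_snd, one_mul,
      infiniteAdeleRingHomeomorph_realToInfiniteAdele_mul,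
      Set.mem_smul_set_iff_inv_smul_mem₀ ht0, Units.val_inv_eq_inv_val, NNReal.coe_inv]
  rw [hset, ← hνS _ (measurableSet_closedBall.const_smul₀ _), Measure.addHaar_smul ν, hνB₀,
    mixedEmbedding.finrank, abs_pow, NNReal.abs_eq, ENNReal.ofReal_pow (NNReal.coe_nonneg _),
    ENNReal.ofReal_coe_nnreal, ENNReal.coe_pow]

/-- **`vol(t • s) = t^{[K:ℚ]} · vol(s)`** on the adele ring: for every regular additive Haar
measure `μ` on `𝔸_K`, every `t > 0` and every set `s`, `μ (posRealIdele K t • s) = t^{[K:ℚ]} μ s`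
(from `AdeleRing.distribHaarChar_posRealIdele` and Mathlib `distribHaarChar_mul`).
Weil, BNT IV §4, Cor. 2 of Thm. 5. [cite: WeilBNT1967, Ch. IV §4, Cor. 2 of Thm. 5] -/
theorem AdeleRing.addHaar_posRealIdele_smul [LocallyCompactSpace (AdeleRing (𝓞 K) K)]
    [MeasurableSpace (AdeleRing (𝓞 K) K)] [BorelSpace (AdeleRing (𝓞 K) K)]
    (μ : Measure (AdeleRing (𝓞 K) K)) [μ.IsAddHaarMeasure] [μ.Regular] (t : ℝ≥0ˣ)
    (s : Set (AdeleRing (𝓞 K) K)) :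
    μ (posRealIdele K t • s) = ((t : ℝ≥0) : ℝ≥0∞) ^ Module.finrank ℚ K * μ s := by
  rw [← distribHaarChar_mul μ, AdeleRing.distribHaarChar_posRealIdele, ENNReal.coe_pow]

end HaarScaling

end Literature.NumberTheory.Automorphic
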